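import Summits.BirchSwinnertonDyer.BirchSwinnertonDyer.Theorems.ThetaPartnerAtTwoSignedControlAtTwoPlusLocShift
import Summits.BirchSwinnertonDyer.BirchSwinnertonDyer.Theorems.ThetaPartnerAtTwoSignedControlAtTwoPlusLocalInjOfLift
import Literature.NumberTheory.EllipticCurves.CyclotomicZpExtensionLocalGeneratorProofs
import HarnessLib

/-!
# THE LOC ENGINE: the `±`-local lift LOC^ε at a place above `p` (Greenberg's Lemma 4.7 surjectivity for the
# Kummer condition cut out by `A ≤ E(K_∞·K_v)`) from the elementwise «`(A ⊗ ℚ_p/ℤ_p)_Γ = 0`»; at `p = 2`: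
# COINV^ε@2, KIM^ε@2 and EC2 from PRINT by name + INJ⁺@2 + ONE elementwise statement (DIV⁺@2) about `E(ℚ_{2,∞})`
# — KIM⁺ series part 8 (LOC engine, second half)

Route `ThetaPartnerAtTwo` (TP2; crux shared with `ResidualThetaTransportAtTwo`), crux K4 `SignedControlAtTwo`
(stmt-BirchSwinnertonDyer-20309), line `eulerchar` v4, stub `stub_plusKimNoFiniteSubmoduleTwo` (KIM⁺@2). Seat
`prover-bsd-wall-tp2-p3-w2` (width seat 2/3). With part 7 (`…PlusLocShift`) this file closes the kernel road from
the door of part 6 down to ONE elementwise local statement: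
(DIV⁺@2) «for every `g ∈ Γ_{ℚ₂}` restricting to a topological generator of `Gal(ℚ_∞/ℚ)`, every
`x ∈ A = ⋃ₙ E⁺(ℚ_{2,n}·ℚ₂)` and `k`, there are `y ∈ A`, `j`, `w ∈ E(ℚ_∞·ℚ₂)` with `2^j x − 2^k (g y − y) = 2^{j+k} w`»
= the image of `E⁺_∞ ⊗ ℚ₂/ℤ₂` in `E(ℚ_{2,∞}) ⊗ ℚ₂/ℤ₂` is `(g − 1)`-divisible = `(E⁺_∞ ⊗ ℚ₂/ℤ₂)_Γ = 0` — the
COINVARIANT twin of w3's (LIFT⁺@2) «`(E⁺_∞ ⊗ ℚ₂/ℤ₂)^Γ = E(ℚ₂) ⊗ ℚ₂/ℤ₂`» behind INJ⁺@2. So after parts 1–8 and w3's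
files the crux K4 on line `eulerchar` reads: PUB {Greenberg Prop. 4.13 (Cassels), Prop. 4.12, pp. 119–120, p. 108,
§5 p. 140 / Kato Thm. 12.4} ∘ THEOREM ∘ {LIFT⁺@2, DIV⁺@2}: the invariants and the coinvariants of ONE local object,
B. D. Kim's `(E⁺(k_∞) ⊗ ℚ_p/ℤ_p)^∨ ≅ Λ` (odd `p`, Props. 2.2–2.3) READ AT `2` for the Honda formal group of `E` at `2`.

WHAT IS PROVED (namespace `…Theorems.SignedEC`):
* §1 `exists_localLift_kummer_of_coinvariantsDiv` — THE ENGINE (any `K`, `p`, `κ`, `E`, `E(E) ≤ A ≤ E(K_∞·E)`, local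
  `g`): (DIV_A) ⇒ for every `t ∈ H¹(K_∞, E[p^∞])` with `conj_{g|} t − t` Kummer-from-`A` there is a `p`-power-torsion
  `x_w ∈ H¹(Γ_E, E(K̄_E))` with «`loc_E y = x_w ⇒ t − res y` Kummer-from-`A`». Step A (the Kummer datum `(Q, k)` of
  `conj_g t − t`, (DIV_A) at `x' = p^{k'} Q'`, a `p^j`-th root `S` of `y`: the shift `f₁ = f₀ − ∂S` is `g`-fixed up to
  `∂T`, `T = Q' − (gS − S) − w` torsion) + part 7.
* §2 `plusLocKummer_two_of_coinvariantsDiv` — at `p = 2` for Kobayashi's `A = ⋃ₙ E^ε(ℚ_{2,n})`: hypothesis `hlocK` of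
  part 6 ⟸ (DIV^ε@2) (w3's `signedSelmerInfty ≤ localKummerOverOfEmb … (⨆ E^ε)`; local generator by
  `ZpExtension.IsCyclotomic.exists_isTopGenerator_resGalOfEmb_adicCompletion`); §3 the door / EC2 with (DIV^ε@2).
HONEST FRAMING: THEOREMS ONLY (no definition, no named fact, no `sorry`), route-independent; (DIV⁺@2) is displayed,
NOT proved; nothing about any curve is asserted; closes no item; BSD is not proved by any of this.

References: [GreenbergLNM1716] §4 Lemma 4.7 (pp. 107–108), Prop. 4.12, Prop. 4.13, pp. 119–120, §5 p. 140;
[BDKim2013] Props. 2.2–2.3, Thm. 3.14, Cor. 3.15; [KitajimaOtsuki2018] Prop. 1.5; [Kobayashi2003] Def. 1.1, §2 p. 4.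
-/

set_option autoImplicit false
-- the Theorems namespace of this sub repeats the summit name by design (D-0017 nested layout)
set_option linter.dupNamespace false

noncomputable section

open scoped Classical NumberField

open NumberField IsDedekindDomain

universe u

namespace Summit.BirchSwinnertonDyer.BirchSwinnertonDyer.Theorems.SignedEC

open Literature.NumberTheory.EllipticCurves Literature.NumberTheory.GaloisRepresentations
  WeierstrassCurve ZpExtension Literature.NumberTheory.EllipticCurves.Kobayashi2003
  Literature.NumberTheory.EllipticCurves.Sprung2012

/-! ## §1 The engine -/

section Engine

variable {K : Type u} [Field K] [NumberField K] (W : WeierstrassCurve K) [W.IsElliptic] {p : ℕ} [Fact p.Prime]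
  (κ : ZpExtension K p) (E : Type u) [Field E] [Algebra K E]

/-- **THE LOC ENGINE — Greenberg's Lemma 4.7 local surjectivity at a place above `p` for the Kummer condition cut
out by `A`, from the elementwise «`(A ⊗ ℚ_p/ℤ_p)_Γ = 0`».** `K` a number field, `W/K` elliptic, `p` prime, `κ` a
`ℤ_p`-extension, `E` a `K`-field (the completion `K_v`) with its chosen embedding, `M = E(K_∞·E)`
(`localTowerPointsOfEmb`), `E(E) ≤ A ≤ M` a subgroup (meant: `A = ⋃ₙ E^ε(K_n·E)`), `g ∈ Γ_E` restricting to a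
topological generator of `κ`. ASSUME (DIV_A): for all `x ∈ A` and `k`, there are `y ∈ A`, `j`, `w ∈ M` with
`p^j x − p^k (g y − y) = p^{j+k} w` — i.e. the class of `x ⊗ p^{-k}` in `M ⊗ ℚ_p/ℤ_p` is `(g − 1)` of the class of
`y ⊗ p^{-j}`: «`A ⊗ ℚ_p/ℤ_p` is `(g − 1)`-divisible», the elementwise form of `(E^ε_∞ ⊗ ℚ_p/ℤ_p)_Γ = 0` (B. D. Kim 2013
Props. 2.2–2.3: `(E^±(k_∞) ⊗ ℚ_p/ℤ_p)^∨ ≅ Λ` at odd `p`). THEN for every `t ∈ H¹(K_∞, E[p^∞])` with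
`conj_{g|} t − t` in the Kummer condition cut out by `A` there is a `p`-power-torsion `x_w ∈ H¹(Γ_E, E(K̄_E))` such that
every `y ∈ H¹(Γ_K, E[p^∞])` with `loc_E y = x_w` has `t − res y` in the Kummer condition cut out by `A`. Proof: Step A
turns the Kummer datum of `conj_g t − t` and (DIV_A) into a shift datum (`S`, `T`); then
`exists_localLift_kummer_of_shift`. [cite: GreenbergLNM1716, §4 Lemma 4.7 (pp. 107–108)]
[cite: BDKim2013, Props. 2.2–2.3 and proof of Cor. 3.15 (p. 199)] [cite: KitajimaOtsuki2018, Prop. 1.5] -/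
theorem exists_localLift_kummer_of_coinvariantsDiv
    (A : AddSubgroup (localPoints W E))
    (hAM : A ≤ localTowerPointsOfEmb κ (closureEmb (K := K) E) W)
    (hA0 : localLayerPointsOfEmb κ (closureEmb (K := K) E) W 0 ≤ A)
    {g : Field.absoluteGaloisGroup E} (hg : κ.IsTopGenerator (resGal (K := K) E g))
    (hdiv : ∀ x ∈ A, ∀ k : ℕ, ∃ y ∈ A, ∃ j : ℕ, ∃ w ∈ localTowerPointsOfEmb κ (closureEmb (K := K) E) W,
      p ^ j • x - p ^ k • (g • y - y) = p ^ (j + k) • w)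
    (t : W.subgroupH1 p κ.kerSubgroup)
    (ht : W.conjH1 p κ.kerSubgroup (resGal (K := K) E g) t - t ∈
      localKummerOverOfEmb W p κ.kerSubgroup (closureEmb (K := K) E) A) :
    ∃ xw : discreteH1 (localSubgroupOfEmb (⊤ : Subgroup (Field.absoluteGaloisGroup K)) (closureEmb (K := K) E))
        (localPoints W E),
      (∃ k : ℕ, p ^ k • xw = 0) ∧
      ∀ y : W.subgroupH1 p (⊤ : Subgroup (Field.absoluteGaloisGroup K)),
        W.localResOverOfEmb p ⊤ (closureEmb (K := K) E) y = xw →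
        t - W.resOfLe p (le_top : κ.kerSubgroup ≤ ⊤) y ∈
          localKummerOverOfEmb W p κ.kerSubgroup (closureEmb (K := K) E) A := by
  -- notation and generalities
  set ι : AlgebraicClosure K →ₐ[K] AlgebraicClosure E := closureEmb (K := K) E with hι
  set M : AddSubgroup (localPoints W E) := localTowerPointsOfEmb κ ι W with hM
  have hMfix : ∀ {P : localPoints W E}, P ∈ M →
      ∀ τ : Field.absoluteGaloisGroup E, τ ∈ localSubgroupOfEmb κ.kerSubgroup ι → τ • P = P :=
    fun {P} hP ↦ (mem_localTowerPointsOfEmb_iff κ ι W P).1 hP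
  have hMsmul : ∀ (σ : Field.absoluteGaloisGroup E) {P : localPoints W E}, P ∈ M → σ • P ∈ M :=
    fun σ {P} hP ↦ smul_mem_localTowerPointsOfEmb κ ι W σ hP
  have hconj : ∀ (σ τ : Field.absoluteGaloisGroup E), τ ∈ localSubgroupOfEmb κ.kerSubgroup ι →
      σ⁻¹ * τ * σ ∈ localSubgroupOfEmb κ.kerSubgroup ι := by
    intro σ τ hτ
    rw [mem_localSubgroupOfEmb_iff] at hτ ⊢
    rw [map_mul, map_mul, map_inv]
    exact κ.kerSubgroup_normal.conj_mem' _ hτ _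
  have hGmem : ∀ {u : Field.absoluteGaloisGroup E}, u ∈ localSubgroupOfEmb κ.kerSubgroup ι →
      resGalOfEmb ι u ∈ κ.kerSubgroup := fun {u} hu ↦ (mem_localSubgroupOfEmb_iff _ ι u).1 hu
  have hγ : resGal (K := K) E g = resGalOfEmb ι g := rfl
  -- Step 0: a cocycle `φ` of `t`; its local values `f0` on `G_∞ = Gal(K̄_E/K_∞·E)`
  obtain ⟨φ, rfl⟩ := oneCocycleClass_surjective (discreteTopRep κ.kerSubgroup (W.geomPrimaryTorsion p)) t
  obtain ⟨f0, hf0⟩ : ∃ f0 : ∀ u : Field.absoluteGaloisGroup E, u ∈ localSubgroupOfEmb κ.kerSubgroup ι →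
      localPoints W E, ∀ u hu, f0 u hu =
      pointsMapOfEmb W ι ((φ.1 ⟨resGalOfEmb ι u, hGmem hu⟩ : W.geomPrimaryTorsion p) : W.geomPoints) :=
    ⟨_, fun _ _ ↦ rfl⟩
  have hf0mul : ∀ (σ τ : Field.absoluteGaloisGroup E) (hσ : σ ∈ localSubgroupOfEmb κ.kerSubgroup ι)
      (hτ : τ ∈ localSubgroupOfEmb κ.kerSubgroup ι),
      f0 (σ * τ) (mul_mem hσ hτ) = f0 σ hσ + σ • f0 τ hτ := by
    intro σ τ hσ hτ
    have hst : (⟨resGalOfEmb ι (σ * τ), hGmem (mul_mem hσ hτ)⟩ : κ.kerSubgroup) =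
        ⟨resGalOfEmb ι σ, hGmem hσ⟩ * ⟨resGalOfEmb ι τ, hGmem hτ⟩ := Subtype.ext (map_mul _ _ _)
    have h := φ.2 ⟨resGalOfEmb ι σ, hGmem hσ⟩ ⟨resGalOfEmb ι τ, hGmem hτ⟩
    rw [hf0 (σ * τ) (mul_mem hσ hτ), hf0 σ hσ, hf0 τ hτ, hst, h, AddSubgroup.coe_add, map_add,
      discreteTopRep_ρ_apply, Subgroup.smul_def, primaryComponent.coe_smul, pointsMapOfEmb_smul]
  have hf0tors : ∀ u hu, ∃ N : ℕ, p ^ N • f0 u hu = 0 := fun u hu ↦ by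
    obtain ⟨N, hN⟩ := AddCommGroup.mem_primaryComponent.mp (φ.1 ⟨resGalOfEmb ι u, hGmem hu⟩).2
    refine ⟨N, ?_⟩
    rw [hf0 u hu, ← map_nsmul, hN, map_zero]
  -- Step A: unpack `conj_γ t − t ∈ Kummer(A)` (γ = res g) at the cocycle level
  have hconjφ : W.conjH1 p κ.kerSubgroup (resGal (K := K) E g) (oneCocycleClass _ φ) =
      oneCocycleClass _ (contOneCocycles.pullback (subgroupConj κ.kerSubgroup (resGalOfEmb ι g))
        (resHomOfEquivariant (subgroupConj κ.kerSubgroup (resGalOfEmb ι g))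
          (DistribSMul.toAddMonoidHom (W.geomPrimaryTorsion p) (resGalOfEmb ι g))
          (ZpExtension.conj_compat κ.kerSubgroup (resGalOfEmb ι g))) φ) :=
    map_oneCocycleClass _ _ _ φ
  rw [hconjφ, ← oneCocycleClass_sub] at ht
  obtain ⟨ψ, Q, k, hψ, hQA, hcob⟩ := ht
  rw [← sub_eq_zero, ← oneCocycleClass_sub, oneCocycleClass_eq_zero_iff] at hψ
  obtain ⟨R₀, hR₀⟩ := hψ
  -- `ψ h = (γ • φ(γ⁻¹ h γ) − φ h) + (h R₀ − R₀)` for `h ∈ ker κ`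
  have hψφ : ∀ h : κ.kerSubgroup, (ψ.1 h : W.geomPrimaryTorsion p) =
      (resGalOfEmb ι g • φ.1 (subgroupConj κ.kerSubgroup (resGalOfEmb ι g) h) - φ.1 h) +
        ((h : Field.absoluteGaloisGroup K) • R₀ - R₀) := by
    intro h
    have h1 := hR₀ h
    rw [Submodule.coe_sub, ContinuousMap.sub_apply, Submodule.coe_sub, ContinuousMap.sub_apply,
      contOneCocycles.pullback_apply, sub_eq_iff_eq_add, discreteTopRep_ρ_apply, Subgroup.smul_def] at h1
    rw [h1, add_comm]
    rfl
  -- on `G_∞`: `g • f0 (g⁻¹ τ g) − f0 τ = τ Q' − Q'` with `Q' = Q − ι R₀`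
  have hgconj_mem : ∀ {τ : Field.absoluteGaloisGroup E}, τ ∈ localSubgroupOfEmb κ.kerSubgroup ι →
      g⁻¹ * τ * g ∈ localSubgroupOfEmb κ.kerSubgroup ι := fun {τ} hτ ↦ hconj g τ hτ
  obtain ⟨R₀', hR₀'⟩ : ∃ R₀' : localPoints W E,
      R₀' = pointsMapOfEmb W ι ((R₀ : W.geomPrimaryTorsion p) : W.geomPoints) := ⟨_, rfl⟩
  obtain ⟨Q', hQ'⟩ : ∃ Q' : localPoints W E, Q' = Q - R₀' := ⟨_, rfl⟩
  have hA1 : ∀ (τ : Field.absoluteGaloisGroup E) (hτ : τ ∈ localSubgroupOfEmb κ.kerSubgroup ι),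
      g • f0 (g⁻¹ * τ * g) (hgconj_mem hτ) - f0 τ hτ = τ • Q' - Q' := by
    intro τ hτ
    have h1 := hcob ⟨τ, hτ⟩
    change pointsMapOfEmb W ι _ = τ • Q - Q at h1
    have h2 := hψφ (resGalSubgroupOfEmb κ.kerSubgroup ι ⟨τ, hτ⟩)
    -- the conjugated argument `γ⁻¹ (res τ) γ = res (g⁻¹ τ g)`
    have hsc : (subgroupConj κ.kerSubgroup (resGalOfEmb ι g) (resGalSubgroupOfEmb κ.kerSubgroup ι ⟨τ, hτ⟩) :
        κ.kerSubgroup) = ⟨resGalOfEmb ι (g⁻¹ * τ * g), hGmem (hgconj_mem hτ)⟩ := by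
      apply Subtype.ext
      show _ = resGalOfEmb ι (g⁻¹ * τ * g)
      rw [subgroupConj_apply_coe, resGalSubgroupOfEmb_apply_coe, map_mul, map_mul, map_inv]
    have hre : (resGalSubgroupOfEmb κ.kerSubgroup ι ⟨τ, hτ⟩ : κ.kerSubgroup) =
        ⟨resGalOfEmb ι τ, hGmem hτ⟩ := rfl
    rw [hsc, hre] at h2
    have h3 := congrArg (fun z : W.geomPrimaryTorsion p ↦ pointsMapOfEmb W ι (z : W.geomPoints)) h2
    simp only at h3
    rw [hre] at h1
    rw [h1, AddSubgroup.coe_add, map_add, AddSubgroup.coe_sub, map_sub, AddSubgroup.coe_sub, map_sub,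
      primaryComponent.coe_smul, pointsMapOfEmb_smul, primaryComponent.coe_smul, pointsMapOfEmb_smul,
      ← hf0 _ (hgconj_mem hτ), ← hf0 τ hτ, ← hR₀'] at h3
    -- `h3 : τ Q − Q = (g • f0 (g⁻¹τg) − f0 τ) + (τ R₀' − R₀')`
    rw [hQ', smul_sub]
    have h4 : g • f0 (g⁻¹ * τ * g) (hgconj_mem hτ) - f0 τ hτ = (τ • Q - Q) - (τ • R₀' - R₀') := by
      rw [h3]; abel
    rw [h4]; abel
  -- a power of `p` killing `R₀`; `k' = k + m₀`, `x' = p^{k'} Q' = p^{m₀} (p^k Q) ∈ A`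
  obtain ⟨m₀, hm₀⟩ : ∃ m₀ : ℕ, p ^ m₀ • R₀ = 0 := by
    obtain ⟨m₀, hm⟩ := AddCommGroup.mem_primaryComponent.mp R₀.2
    exact ⟨m₀, Subtype.ext (by rw [AddSubmonoidClass.coe_nsmul, hm, ZeroMemClass.coe_zero])⟩
  have hR₀'tors : p ^ m₀ • R₀' = 0 := by
    rw [hR₀', ← map_nsmul, ← AddSubmonoidClass.coe_nsmul, hm₀, ZeroMemClass.coe_zero, map_zero]
  obtain ⟨k', hk'⟩ : ∃ k' : ℕ, k' = k + m₀ := ⟨_, rfl⟩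
  obtain ⟨x', hx'⟩ : ∃ x' : localPoints W E, x' = p ^ k' • Q' := ⟨_, rfl⟩
  have hx'eq : x' = p ^ m₀ • (p ^ k • Q) := by
    have e1 : p ^ k' • R₀' = 0 := by rw [hk', pow_add, mul_smul, hR₀'tors, smul_zero]
    rw [hx', hQ', smul_sub, e1, sub_zero, hk', pow_add, mul_comm, mul_smul]
  have hx'A : x' ∈ A := by rw [hx'eq]; exact AddSubgroup.nsmul_mem _ hQA _
  -- (DIV_A) at `x'`, `k'`: `p^j x' − p^{k'} (g y − y) = p^{j+k'} w`
  obtain ⟨y, hyA, j, w, hwM, hdiv'⟩ := hdiv x' hx'A k'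
  have hyM : y ∈ M := hAM hyA
  -- a `p^j`-th root `S` of `y`, and the torsion point `T = Q' − (g S − S) − w`
  obtain ⟨S, hS⟩ := W.nsmul_surjective_localPoints E (pow_ne_zero j (Fact.out : p.Prime).ne_zero) y
  simp only at hS
  obtain ⟨T, hT⟩ : ∃ T : localPoints W E, T = Q' - (g • S - S) - w := ⟨_, rfl⟩
  have hTtors : p ^ (j + k') • T = 0 := by
    have e1 : p ^ (j + k') • Q' = p ^ j • x' := by rw [hx', pow_add, mul_smul]
    have e2 : p ^ (j + k') • (g • S - S) = p ^ k' • (g • y - y) := by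
      rw [pow_add, mul_comm, mul_smul, smul_sub (p ^ j), smul_comm (p ^ j) g S, hS]
    rw [hT, smul_sub, smul_sub, e1, e2, hdiv', sub_self]
  -- (iii) `g`-invariance up to the coboundary of the torsion point `T`
  have hf1conj : ∀ (τ : Field.absoluteGaloisGroup E) (hτ : τ ∈ localSubgroupOfEmb κ.kerSubgroup ι),
      g • (f0 (g⁻¹ * τ * g) (hgconj_mem hτ) - ((g⁻¹ * τ * g) • S - S)) - (f0 τ hτ - (τ • S - S)) =
        τ • T - T := by
    intro τ hτ
    have e1 : g • ((g⁻¹ * τ * g) • S - S) = τ • g • S - g • S := by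
      rw [smul_sub, ← mul_smul, show g * (g⁻¹ * τ * g) = τ * g by group, mul_smul]
    have e2 : τ • w = w := hMfix hwM τ hτ
    have e3 := hA1 τ hτ
    have e4 : τ • T - T = (τ • Q' - Q') - ((τ • g • S - g • S) - (τ • S - S)) := by
      rw [hT, smul_sub, smul_sub, smul_sub, e2]; abel
    rw [smul_sub g, e1, e4, ← e3]
    abel
  -- Steps B–D (`E ⊇ K` has characteristic zero)
  haveI : CharZero E := charZero_of_injective_algebraMap (algebraMap K E).injective
  refine exists_localLift_kummer_of_shift W κ E A hAM hA0 hg φ S T ⟨j, by rw [hS]; exact hyA⟩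
    ⟨j + k', hTtors⟩ fun τ τ' hτ' ↦ ?_
  have e : τ' = ⟨g⁻¹ * τ * g, hgconj_mem τ.2⟩ := Subtype.ext hτ'
  subst e
  have h := hf1conj τ.1 τ.2
  rw [hf0 _ (hgconj_mem τ.2), hf0 τ.1 τ.2] at h
  exact h

end Engine

/-! ## §2 `p = 2`: the level-`∞` Kummer form of LOC^ε@2 from (DIV^ε@2) -/

section Two

open Literature.NumberTheory.EllipticCurves.Rank1Residual
  Literature.NumberTheory.EllipticCurves.GreenbergVatsal2000 Literature.NumberTheory.EllipticCurves.IwasawaDual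
  Literature.NumberTheory.EllipticCurves.IwasawaAlgebra

variable (W : WeierstrassCurve ℚ) [W.IsElliptic] [W.IsGloballyMinimal] (κ : ZpExtension ℚ 2) (ε : ℤˣ)

omit [W.IsGloballyMinimal] in
/-- **LOC^ε@2 in the level-`∞` Kummer form (hypothesis `hlocK` of part 6's door), for one class `t` and the place
`w ∋ 2`, from (DIV^ε@2).** `κ` cyclotomic; `t ∈ H¹(ℚ_∞, E[2^∞])` with `conj_σ t − t ∈ Sel^ε(E/ℚ_∞)` for all `σ`; if
for every `g ∈ Γ_{ℚ_w}` restricting to a topological generator and every `x ∈ A = ⋃ₙ E^ε(ℚ_{2,n}·ℚ_w)`, `k`, there are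
`y ∈ A`, `j`, `w' ∈ E(ℚ_∞·ℚ_w)` with `2^j x − 2^k (g y − y) = 2^{j+k} w'`, then some `2`-power-torsion
`x_w ∈ H¹(Γ_{ℚ_w}, E(ℚ̄_w))` has «`loc_w y = x_w ⇒ t − res y ∈ localKummerOverOfEmb W 2 (ker κ) (closureEmb ℚ_w) A`».
Inputs: the engine of §1 with `E(ℚ_w) = E^ε_0 ≤ A ≤ E(ℚ_∞·ℚ_w)`, w3's `signedSelmerInfty ≤ localKummerOverOfEmb … A`,
and a local lift `g` of the generator (`2` is totally ramified in `ℚ_∞`: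
`ZpExtension.IsCyclotomic.exists_isTopGenerator_resGalOfEmb_adicCompletion`).
[cite: GreenbergLNM1716, §4 Lemma 4.7 (pp. 107–108)] [cite: BDKim2013, Props. 2.2–2.3] [cite: Kobayashi2003, §2 p. 4] -/
theorem plusLocKummer_two_of_coinvariantsDiv (hκ : κ.IsCyclotomic)
    {w : HeightOneSpectrum (𝓞 ℚ)} (hw : ((2 : ℕ) : 𝓞 ℚ) ∈ w.asIdeal)
    (hDIV : ∀ g : Field.absoluteGaloisGroup (w.adicCompletion ℚ),
      κ.IsTopGenerator (resGal (K := ℚ) (w.adicCompletion ℚ) g) →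
      ∀ x ∈ (⨆ n, signedLocalPoints κ (w.adicCompletion ℚ) W ε n), ∀ k : ℕ,
        ∃ y ∈ (⨆ n, signedLocalPoints κ (w.adicCompletion ℚ) W ε n), ∃ j : ℕ,
          ∃ w' ∈ localTowerPointsOfEmb κ (closureEmb (K := ℚ) (w.adicCompletion ℚ)) W,
            2 ^ j • x - 2 ^ k • (g • y - y) = 2 ^ (j + k) • w')
    (t : W.subgroupH1 2 κ.kerSubgroup)
    (ht : ∀ σ : Field.absoluteGaloisGroup ℚ, W.conjH1 2 κ.kerSubgroup σ t - t ∈ signedSelmerInfty W κ ε) :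
    ∃ xw : discreteH1 (localSubgroup (⊤ : Subgroup (Field.absoluteGaloisGroup ℚ)) (w.adicCompletion ℚ))
        (localPoints W (w.adicCompletion ℚ)),
      (∃ k : ℕ, 2 ^ k • xw = 0) ∧
      ∀ y : W.subgroupH1 2 (⊤ : Subgroup (Field.absoluteGaloisGroup ℚ)),
        W.localResOver 2 ⊤ (w.adicCompletion ℚ) y = xw →
        t - W.resOfLe 2 (le_top : κ.kerSubgroup ≤ ⊤) y ∈
          localKummerOverOfEmb W 2 κ.kerSubgroup (closureEmb (K := ℚ) (w.adicCompletion ℚ))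
            (⨆ n, signedLocalPoints κ (w.adicCompletion ℚ) W ε n) := by
  obtain ⟨g, hg⟩ := hκ.exists_isTopGenerator_resGalOfEmb_adicCompletion w hw
  have hg' : κ.IsTopGenerator (resGal (K := ℚ) (w.adicCompletion ℚ) g) := hg
  have hAM := iSup_signedLocalPointsOfEmb_le_localTowerPointsOfEmb W κ ε
    (closureEmb (K := ℚ) (w.adicCompletion ℚ))
  have hA0 : localLayerPointsOfEmb κ (closureEmb (K := ℚ) (w.adicCompletion ℚ)) W 0 ≤
      ⨆ n, signedLocalPoints κ (w.adicCompletion ℚ) W ε n :=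
    (signedLocalPointsOfEmb_zero κ _ W ε).symm.le.trans
      (le_iSup (fun n ↦ signedLocalPoints κ (w.adicCompletion ℚ) W ε n) 0)
  have ht' := signedSelmerInfty_le_localKummerOverOfEmb_iSup_signedLocalPoints W κ ε w hw
    (ht (resGal (K := ℚ) (w.adicCompletion ℚ) g))
  obtain ⟨xw, hk, hmain⟩ := exists_localLift_kummer_of_coinvariantsDiv W κ (w.adicCompletion ℚ)
    (⨆ n, signedLocalPoints κ (w.adicCompletion ℚ) W ε n) hAM hA0 hg' (hDIV g hg') t ht'
  exact ⟨xw, hk, fun y hy ↦ hmain y hy⟩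

/-- **THE DOOR with the `±`-local input as the elementwise (DIV^ε@2)**: `(Sel^ε(E/ℚ_∞))_γ = 0` from the five PRINT
facts by name, `Sel_{2^∞}(E/ℚ)` finite, and (DIV^ε@2) at the place(s) `w ∋ 2` (part 6's door ∘ §2).
[cite: GreenbergLNM1716, §4 Prop. 4.12, Prop. 4.13, pp. 107–108, 119–120, §5 p. 140] [cite: BDKim2013, Props. 2.2–2.3,
Thm. 3.14] -/
theorem signedEndCoinvariants_subsingleton_two_of_print_of_coinvariantsDiv (hss : GoodSS W 2)
    (hκ : κ.IsCyclotomic) {γ : Field.absoluteGaloisGroup ℚ} (hγ : κ.IsTopGenerator γ)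
    (S₀ : Finset (HeightOneSpectrum (𝓞 ℚ)))
    (hgood : ∀ w : HeightOneSpectrum (𝓞 ℚ), w ∉ S₀ → ((2 : ℕ) : 𝓞 ℚ) ∉ w.asIdeal → W.HasGoodReductionAt w)
    (hC : Greenberg1999.casselsSurjectivity_H1Sigma ℚ)
    (h412 : Greenberg1999.prop412_noFiniteSubmodule_H1Sigma_of_rank_one)
    (hcork : Greenberg1999.h1Sigma_zpCorank_le_degree ℚ)
    (hP108 : Greenberg1999.localQuotient_restriction_surjective ℚ)
    (hWL : Greenberg1999.h1SigmaInfty_rank_eq_one)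
    (hDIV : ∀ w : HeightOneSpectrum (𝓞 ℚ), ((2 : ℕ) : 𝓞 ℚ) ∈ w.asIdeal →
      ∀ g : Field.absoluteGaloisGroup (w.adicCompletion ℚ),
      κ.IsTopGenerator (resGal (K := ℚ) (w.adicCompletion ℚ) g) →
      ∀ x ∈ (⨆ n, signedLocalPoints κ (w.adicCompletion ℚ) W ε n), ∀ k : ℕ,
        ∃ y ∈ (⨆ n, signedLocalPoints κ (w.adicCompletion ℚ) W ε n), ∃ j : ℕ,
          ∃ w' ∈ localTowerPointsOfEmb κ (closureEmb (K := ℚ) (w.adicCompletion ℚ)) W,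
            2 ^ j • x - 2 ^ k • (g • y - y) = 2 ^ (j + k) • w')
    (hSel : Finite (W.selmerGroupPInfty 2)) :
    Subsingleton (EndCoinvariants (conjSignedSelmerInfty W κ ε γ - 1)) :=
  signedEndCoinvariants_subsingleton_two_of_print_of_kummerLoc W κ ε hss hκ hγ S₀ hgood hC h412 hcork hP108 hWL
    (fun t _ hconj w hw ↦ plusLocKummer_two_of_coinvariantsDiv W κ ε hκ hw (hDIV w hw) t hconj) hSel

/-- **EC2 (the skeleton's `signedEulerCharTwo` body for `W`, `κ`, `γ`) from INJ⁺@2 + the five PRINT facts + (DIV⁺@2).**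
So on line `eulerchar`: K4 = PUB ∘ THEOREM ∘ {INJ⁺@2 (⟸ LIFT⁺@2, w3), DIV⁺@2} — two elementwise statements about the
one `Γ_{ℚ₂}`-module `E(ℚ_{2,∞})` filtered by Kobayashi's `E⁺(ℚ_{2,n})`.
[cite: BDKim2013, Cor. 3.15, Props. 2.2–2.3] [cite: GreenbergLNM1716, §4 pp. 102–109, Prop. 4.12, Prop. 4.13,
pp. 119–122, §5 p. 140] -/
theorem signedEulerChar_two_of_localInj_of_print_of_coinvariantsDiv (hss : GoodSS W 2) (hκ : κ.IsCyclotomic)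
    {γ : Field.absoluteGaloisGroup ℚ} (hγ : κ.IsTopGenerator γ)
    (S₀ : Finset (HeightOneSpectrum (𝓞 ℚ)))
    (hgood : ∀ w : HeightOneSpectrum (𝓞 ℚ), w ∉ S₀ → ((2 : ℕ) : 𝓞 ℚ) ∉ w.asIdeal → W.HasGoodReductionAt w)
    (hinj : ∀ v : HeightOneSpectrum (𝓞 ℚ), (2 : 𝓞 ℚ) ∈ v.asIdeal →
      ∀ y ∈ (signedSelmerInfty W κ 1).comap (W.layerToInfty κ 0),
        W.localResOver 2 (κ.layerSubgroup 0) (v.adicCompletion ℚ) y = 0)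
    (hC : Greenberg1999.casselsSurjectivity_H1Sigma ℚ)
    (h412 : Greenberg1999.prop412_noFiniteSubmodule_H1Sigma_of_rank_one)
    (hcork : Greenberg1999.h1Sigma_zpCorank_le_degree ℚ)
    (hP108 : Greenberg1999.localQuotient_restriction_surjective ℚ)
    (hWL : Greenberg1999.h1SigmaInfty_rank_eq_one)
    (hDIV : ∀ w : HeightOneSpectrum (𝓞 ℚ), ((2 : ℕ) : 𝓞 ℚ) ∈ w.asIdeal →
      ∀ g : Field.absoluteGaloisGroup (w.adicCompletion ℚ),
      κ.IsTopGenerator (resGal (K := ℚ) (w.adicCompletion ℚ) g) →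
      ∀ x ∈ (⨆ n, signedLocalPoints κ (w.adicCompletion ℚ) W 1 n), ∀ k : ℕ,
        ∃ y ∈ (⨆ n, signedLocalPoints κ (w.adicCompletion ℚ) W 1 n), ∃ j : ℕ,
          ∃ w' ∈ localTowerPointsOfEmb κ (closureEmb (K := ℚ) (w.adicCompletion ℚ)) W,
            2 ^ j • x - 2 ^ k • (g • y - y) = 2 ^ (j + k) • w')
    (hSel : Finite (W.selmerGroupPInfty 2)) :
    Finite (endInvariants (conjSignedSelmerInfty W κ 1 γ - 1)) ∧
      ∃ u : ℤ_[2]ˣ, (Nat.card (endInvariants (conjSignedSelmerInfty W κ 1 γ - 1)) : ℚ_[2]) =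
        ((u : ℤ_[2]) : ℚ_[2]) * ((2 : ℕ) : ℚ_[2]) ^ (padicValNat 2 W.tamagawaProduct) *
          (Nat.card (W.selmerGroupPInfty 2) : ℚ_[2]) *
            (Nat.card (EndCoinvariants (conjSignedSelmerInfty W κ 1 γ - 1)) : ℚ_[2]) :=
  signedEulerChar_two_of_localInj_of_print_of_kummerLoc W κ hss hκ hγ S₀ hgood hinj hC h412 hcork hP108 hWL
    (fun t _ hconj w hw ↦ plusLocKummer_two_of_coinvariantsDiv W κ 1 hκ hw (hDIV w hw) t hconj) hSel

end Two

end Summit.BirchSwinnertonDyer.BirchSwinnertonDyer.Theorems.SignedEC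

end
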